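import Summits.QuantumFields.BalabanUV.T4Continuum.Support.B13AssemblyCoresEnd
import Summits.QuantumFields.BalabanUV.T4Continuum.Support.B13TermRepLoc
import Summits.QuantumFields.BalabanUV.T4Continuum.Support.B13StepEndArithmetic

/-!
# B13AssemblyCoresEndActNorm — NE5 ∕ U3: the (2.14)-FACTOR-CORE END OF RECORD (leaf-08-g3 /9 `B13AssemblyCoresEnd`, R28∕R32) with its two
# TERMWISE BUDGET BINDERS read from the ACTIVITY-NORM CURRENCY of row O1-d3 (`B13TermRepLoc`): the weight `a`, the constant `G`, the
# per-domain factor-mass budget `hmaj` and `hbud : TermBudgetLoc a G` DISCHARGED from a STRIPPED factor-mass majorant `A′`, the factorwise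
# decay split and the anchored exponential norm `Φ′` (`36Φ′ < 1`) — `G := Φ′∕(1 − 36Φ′)`, VOLUME-UNIFORM
# (cell `pub-balaban`, T⁴ fan-out, `HOME/BINDER-OWNERS.md` row NE5; unit `b2b-balaban-t4-ne5-formalise-leaf-04`, gen 3; journal INTENT l.13376)

HONEST FRAMING (T4-DAG PAGE 1).  Rung (B)+1 on ONE finite four-torus of fixed physical size — NOT infinite volume, NOT a mass gap, NOT
the Clay problem; `FlowStep.BetaPertH`, (B), (B^μ) do not occur here.  NE5 (`T4OutputRate.NE5`) is NOT PRINTED and NOT PROVED (spine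
0/9, unchanged); every END below is an IMPLICATION from displayed binders, a composition BY NAME of landed faces.  Nothing of the
manuscripts under audit is asserted; 0 cite tags; printed KIND only: [II] = [Balaban1988RG2Cluster] Lemma 3 (2.38) p. 20 (activity bound
per localized factor), (2.40) p. 21 (decay extracted factorwise), (1.26) (the anchored exponential norm is small), (2.39)–(2.41) p. 21 (the
sum over the terms at a fixed domain).  HONEST DEPENDENCY (cell, verbatim): continuum YM on T⁴ ⇐ BetaPertH ∧ nine spine estimates (0/9
proved); BetaPertH ⇐ (D1) ∧ (D4) ∧ CAP+tail; G-an2-4 gates asym, D1 and NE2/3/4.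

WHY (owner rulings R28∕R32, journal l.12164∕l.12675; /9's LANDED line l.13300).  /9 is the most-reduced END face of record: leaf-09's
(2.14)-face on the sub-slot of record at `act := actOfCores 𝔠` with the Gaussian dictionary PRODUCED from the FACTOR operator letters and
the Gaussian mass PRODUCED from the per-domain factor-mass budget.  R32 asked /9 to keep the two termwise budget binders — `hmaj :
actMajorant 𝒯 inc (factorMass 𝔠 N₀f bf m⋆ (H k)) k X i ≤ a k i X·e^{−κd X}` and `hbud : TermBudgetLoc a G` — DISPLAYED AND SEPARATE, and
/9's LANDED line names this lineage's `B13TermRepLoc` (p218395) as their natural supplier.  This SEPARATE follower composes the two BY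
NAME: at the R21 weight `a k i X := actMajorant 𝒯 inc (factorMass … (H k)) k X i·e^{κd X}` the budget `hmaj` holds with equality
(`B13TermRepLoc.actMajorant_le_weight`), and `TermBudgetLoc a (Φ′∕(1 − 36Φ′))` is `B13TermRepLoc.termBudgetLoc_record_of_actNormDecayU` —
leaf-08's Ursell ∕ tree-graph engine (`UrsellTermBudget`, `UrsellTermDecay`) on the term indexing ∕ hard core OF RECORD with footprint
locality, reach ν = 9 and (2.27) c = 5 DISCHARGED by `B13DomainGeometryTR` — fed by (i) the factorwise split of the factor masses against
a STRIPPED majorant `A′ k` (`factorMass … (H k) Z ℓ ≤ A′ k Z ℓ·e^{−κ(d Z + 5)}`, κ ≥ 0; (2.40)-KIND, displayed) and (ii) the anchored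
exponential norm of `A′ k` on every `R.domAt k` at most `Φ′` with `36Φ′ < 1` ((2.38)+(1.26)-KIND, displayed).

WHAT THIS MODULE IS (bookkeeping ∕ [folklore]; 0 new definitions; all conclusions are the tree's shapes BY NAME):
* §1 GENERIC (`Op`-polymorphic, any `AssemblyOn 𝔄` with `𝔄.act = actOfCores 𝔠`): `ne5_of_assemblyOn_cores_actBudget` — /9 §1
  `ne5_of_assemblyOn_cores` with {`a`, `hbud`, `hmaj`} REPLACED by ONE per-domain budget-with-decay binder `hbudD : ∀ k X, scale X = k →
  Summable (actMajorant 𝔄.𝒯 𝔄.inc (factorMass 𝔠 N₀f bf m⋆ (H k)) k X) ∧ Σ' i, actMajorant … k X i ≤ G·e^{−κd X}` ((2.39)–(2.41)-KIND at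
  fixed `X`, displayed; `G`, `hG` kept) — `B13TermRepLoc.termBudgetLoc_of_actBudgetDecay` + `actMajorant_le_weight`.
* §2 ON THE RECORD SUB-SLOT: `ne5_of_record_onSub_cores_actNorm` — /9 §2 `ne5_of_record_onSub_cores S₀ M hMA hMB 𝔠 E₀ cB …` with, binder
  by binder: MINUS {`a`, `G`, `hbud`, `hmaj`, `hG`} ∣ PLUS {`hκ : 0 ≤ κ`, `A′` with `hA0′ : 0 ≤ A′`, `hdec`, `Φ′` with `hΦ0 : 0 ≤ Φ′`,
  `hsmallΦ : 36Φ′ < 1`, `hΦ`} ∣ CHANGED {`hsmall` and the conclusion's constant under `G ↦ Φ′∕(1 − 36Φ′)` only} ∣ every other binder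
  VERBATIM and in /9's order.  Conclusion LITERALLY `NE5 (outA (onSub S₀ M hMA hMB (actOfCores 𝔠)) E₀ cB) (outB (onSub S₀ M hMA hMB
  (actOfCores 𝔠)) E₀ cB) W κ θ′ C₅`.
* §3 THE CHAINED FACE `exists_ne5_of_record_onSub_cores_actNorm` — §2 with the arithmetic letters `ρ₀`, `k₀`, `B` (and `E₁ := 1`)
  ELIMINATED by leaf-10's pattern BY NAME (`B13StepEndArithmetic.reach_elim_iff` ∕ `OutputRateArithmetic.reach_binders_exists` ∕
  `smallness_of_gain`): `0 < θ < 1` and the two strict size inequalities `cA(EA₀ + E₀) < 1 − ω`,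
  `ω + (Φ′∕(1 − 36Φ′))·cA·(1 − ω)∕(1 − ω − cA(EA₀ + E₀)) < θ′` ⟹ `∃ C₅, NE5 … C₅` (division of labour with leaf-10-g6, journal l.13419 ∕ l.13517:
  the budget discharge lives here, the letter elimination of /9 ITSELF in leaf-10's `B13AssemblyCoresEndArithmetic`; the chained face is
  carried ONCE, here).
STATUS (census, Edison rule).  Discharges NO estimate of [II]: the factor operator letters, the stripped majorant's factorwise decay split
(2.40) and anchored-norm smallness (2.38)+(1.26), the transport reading, the slice budgets (W3 side), the levels (L05∕L06), W1 in row NE2's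
entry currency + floor, W4, rooms and the numerics (L10 `k₀`∕`B`, L11 `ρ₀`, S) stay DISPLAYED; what changes is that the termwise side of the
most-reduced END of record reads from ONE currency — the same activity-level currency as E1[rec] (`B13TermRepLoc` §3), E8[rec] and E9[rec] —
with `G` volume-uniform.  DISJOINT from leaf-10's arithmetic follower of /9 (letters ρ₀∕k₀∕B∕E₁ eliminated THERE, kept here).  NE5 NOT
PROVED; 0/12 leaves on Bałaban's concrete objects; spine 0/9; rung (B)+1 finite T⁴; NOT infinite volume ∕ mass gap ∕ Clay.  0 sorry;
axioms ⊆ {propext, Classical.choice, Quot.sound}.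
-/

noncomputable section

open scoped BigOperators
open Set Metric MeasureTheory

namespace Summit.QuantumFields.BalabanUV.T4Continuum.B13AssemblyCoresEndActNorm

open Literature.MathematicalPhysics.QuantumFieldTheory.Balaban1983to89
open Literature.MathematicalPhysics.QuantumFieldTheory.Balaban1983to89.T4OutputRate (Carriers Functional DecayBound NE5)
open Literature.MathematicalPhysics.QuantumFieldTheory.Balaban1983to89.T4InputCauchyRateData (StepModel)
open Summit.QuantumFields.BalabanUV.T4Continuum.B13Carriers (TwoRuns)
open Summit.QuantumFields.BalabanUV.T4Continuum.B13OpDatum (OpDatum)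
open Summit.QuantumFields.BalabanUV.T4Continuum.B13OpDatumJunctions (opOf RawBounded WeightedEntrywiseRate)
open Summit.QuantumFields.BalabanUV.T4Continuum.B13StepTermLabels (TermIdx InnerLabel)
open Summit.QuantumFields.BalabanUV.T4Continuum.B13StepTermFamily (TermIndexing term)
open Summit.QuantumFields.BalabanUV.T4Continuum.B13StepTermSocket (labelsIndexing touchInc)
open Summit.QuantumFields.BalabanUV.T4Continuum.B13InnerData (Bnd b13InnerData)
open Summit.QuantumFields.BalabanUV.T4Continuum.B13HistMeasurable (MeasPotFrame B13HistM)
open Summit.QuantumFields.BalabanUV.T4Continuum.B13TermRep (actMajorant)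
open Summit.QuantumFields.BalabanUV.T4Continuum.B13TermParamGaussianBi (BiCore)
open Summit.QuantumFields.BalabanUV.T4Continuum.B13TermCoreFamily (actOfCores factorCores)
open Summit.QuantumFields.BalabanUV.T4Continuum.B13TermCoreMass (factorMass factorMass_nonneg)
open Summit.QuantumFields.BalabanUV.T4Continuum.UrsellTreeSum (ind)
open Summit.QuantumFields.BalabanUV.T4Continuum.UrsellTermBudget (actSum)
open Summit.QuantumFields.BalabanUV.T4Continuum.B13DomainGeometryTR (SCube footprint domainGeometry)
open Summit.QuantumFields.BalabanUV.T4Continuum.B13Base (selfCtr)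
open Summit.QuantumFields.BalabanUV.T4Continuum.B13RepresentsOn (AssemblyOn)
open Summit.QuantumFields.BalabanUV.T4Continuum.B13StepOfRecord (Slots assembly step)
open Summit.QuantumFields.BalabanUV.T4Continuum.B13StepOfRecordSub (onSub outA outB)
open Summit.QuantumFields.BalabanUV.T4Continuum.B13TermRepLoc (actMajorant_le_weight termBudgetLoc_of_actBudgetDecay
  termBudgetLoc_record_of_actNormDecayU)
open Summit.QuantumFields.BalabanUV.T4Continuum.B13AssemblyCoresEnd (ne5_of_assemblyOn_cores ne5_of_record_onSub_cores)
open Summit.QuantumFields.BalabanUV.T4Continuum.B13StepEndArithmetic (reach_elim_iff smallness_of_gain)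
open Summit.QuantumFields.BalabanUV.T4Continuum.OutputRateArithmetic (reach_binders_exists)

/-! ## §1 Generic: the (2.14)-factor-core face over any operator carrier with ONE per-domain budget-with-decay binder -/

section OverOp

variable {C : Carriers} {P : MeasPotFrame C} {Op IOp : Type*} [NormedAddCommGroup Op] [NormedSpace ℂ Op] {ι Pol J : Type*}
  {𝒴 : Pol → J → Type*} {dom : ∀ Z j, 𝒴 Z j → C.Dom} {PΛ : Pol → J → Type*} {V : Pol → J → Type*}
  [∀ Z j, MeasurableSpace (PΛ Z j)] [∀ Z j, NormedAddCommGroup (V Z j)] [∀ Z j, InnerProductSpace ℝ (V Z j)]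
  [∀ Z j, MeasurableSpace (V Z j)] [∀ Z j, BorelSpace (V Z j)] [∀ Z j, FiniteDimensional ℝ (V Z j)]

/-- [folklore] **THE (2.14)-FACE WITH FACTOR CORES, ASSEMBLED STEP OVER `Op`, ONE BUDGET BINDER** — /9 §1
`B13AssemblyCoresEnd.ne5_of_assemblyOn_cores 𝔄 𝔠 hact …` with its weight `a`, its per-domain factor-mass budget `hmaj` and its
`hbud : TermBudgetLoc a G` REPLACED by the single per-domain budget-with-decay binder `hbudD` ((2.39)–(2.41)-KIND at a fixed step-`k`
domain `X`, displayed): the combinatorial majorant of the factor masses is summable over the tuples localizing at `X` with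
`Σ' ≤ G·e^{−κd X}`.  PROOF: /9 §1 at the R21 weight `a k i X := actMajorant 𝔄.𝒯 𝔄.inc (factorMass 𝔠 N₀f bf m⋆ (H k)) k X i·e^{κd X}`
(`B13TermRepLoc.actMajorant_le_weight`, `termBudgetLoc_of_actBudgetDecay`).  Every other binder VERBATIM; SAME constant.  NOT a proof
of NE5 for Bałaban's step. -/
theorem ne5_of_assemblyOn_cores_actBudget (𝔄 : AssemblyOn C Op IOp (B13HistM P) ι Pol J)
    (𝔠 : ∀ Z j, BiCore P (dom Z j) Op (PΛ Z j) (V Z j)) (hact : 𝔄.act = actOfCores 𝔠)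
    {W : Set (ℕ → ℝ)} {ROp RHist R' H : ℕ → ℝ} {N₀f mf bf : Pol → J → ℝ}
    {mstar κ G EA₀ E₀ E₁ cA cB δ δ' θ θ' ρ₀ B : ℝ} {k₀ : ℕ}
    (hT : 𝔄.TransportReads W)
    (hbB : 𝔄.SliceBudgetB W κ cB) (hbA : 𝔄.D.SliceBudget (𝔄.stepOn (𝔄.bHist E₀ cB)) W κ cA)
    (hdA : DecayBound (𝔄.outA (𝔄.bHist E₀ cB)) W EA₀ κ) (hdB : DecayBound (𝔄.outB (𝔄.bHist E₀ cB)) W E₀ κ)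
    (hop : (𝔄.stepOn (𝔄.bHist E₀ cB)).OperatorRate W δ θ) (hins : (𝔄.stepOn (𝔄.bHist E₀ cB)).InsertionRate W κ E₀ δ' θ)
    (hOp : ∀ k, 𝔄.rOp k ≤ ROp k) (hroom : ∀ k, ROp k < R' k)
    (hHist : ∀ k, 𝔄.bHist E₀ cB k + 𝔄.rHist k ≤ RHist k)
    -- the FACTOR operator letters of the cores (as in /9 §1)
    (hm : 0 < mstar) (hmf : ∀ Z j, mstar ≤ mf Z j) (hwB : ∀ Z j, 0 ≤ (𝔠 Z j).wB) (hN₀ : ∀ Z j, 0 ≤ N₀f Z j)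
    (hNf : ∀ k, ∀ g ∈ W, ∀ (U : C.BgB) (X : C.Dom), C.scale X = k → ∀ i, 𝔄.𝒯.Rel k i X → ∀ m : Fin (𝔄.𝒯.len i + 1),
      (∀ o ∈ ball (selfCtr 𝔄.raw 𝔄.histRef k g U).1 (R' k),
        AEStronglyMeasurable ((factorCores 𝔄.𝒯 𝔠 i m).N o) (factorCores 𝔄.𝒯 𝔠 i m).lam) ∧
      (∀ p, DifferentiableOn ℂ (fun o => (factorCores 𝔄.𝒯 𝔠 i m).N o p) (ball (selfCtr 𝔄.raw 𝔄.histRef k g U).1 (R' k))) ∧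
      (∀ o ∈ ball (selfCtr 𝔄.raw 𝔄.histRef k g U).1 (R' k), ∀ p,
        ‖(factorCores 𝔄.𝒯 𝔠 i m).N o p‖ ≤ N₀f (𝔄.𝒯.poly i m) (𝔄.𝒯.lab i m)))
    (hqf : ∀ k, ∀ g ∈ W, ∀ (U : C.BgB) (X : C.Dom), C.scale X = k → ∀ i, 𝔄.𝒯.Rel k i X → ∀ m : Fin (𝔄.𝒯.len i + 1),
      (∀ o ∈ ball (selfCtr 𝔄.raw 𝔄.histRef k g U).1 (R' k),
        AEStronglyMeasurable (Function.uncurry ((factorCores 𝔄.𝒯 𝔠 i m).q o)) ((factorCores 𝔄.𝒯 𝔠 i m).lam.prod volume)) ∧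
      (∀ p v, DifferentiableOn ℂ (fun o => (factorCores 𝔄.𝒯 𝔠 i m).q o p v) (ball (selfCtr 𝔄.raw 𝔄.histRef k g U).1 (R' k))) ∧
      (∀ o ∈ ball (selfCtr 𝔄.raw 𝔄.histRef k g U).1 (R' k), ∀ p v,
        mf (𝔄.𝒯.poly i m) (𝔄.𝒯.lab i m) * ‖v‖ ^ 2 - bf (𝔄.𝒯.poly i m) (𝔄.𝒯.lab i m) ≤ ((factorCores 𝔄.𝒯 𝔠 i m).q o p v).re))
    -- the history radius, and the ONE per-domain budget-with-decay binder (replaces `a`, `hmaj`, `hbud`)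
    (hH : ∀ k, ∀ g ∈ W, ∀ U : C.BgB, ‖(selfCtr 𝔄.raw 𝔄.histRef k g U).2‖ + RHist k ≤ H k)
    (hbudD : ∀ (k : ℕ) (X : C.Dom), C.scale X = k →
      Summable (actMajorant 𝔄.𝒯 𝔄.inc (factorMass 𝔠 N₀f bf mstar (H k)) k X) ∧
        ∑' i, actMajorant 𝔄.𝒯 𝔄.inc (factorMass 𝔠 N₀f bf mstar (H k)) k X i ≤ G * Real.exp (-(κ * C.d X)))
    (hE₀ : 0 ≤ E₀) (hE₁ : 0 < E₁) (hG : 0 ≤ G) (hcA : 0 ≤ cA) (hcB : 0 ≤ cB) (hδ : 0 ≤ δ) (hδ' : 0 ≤ δ')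
    (hθ : 0 ≤ θ) (hθθ' : θ ≤ θ') (hθ'1 : θ' ≤ 1) (hω : 0 < 𝔄.D.ω) (hω1 : 𝔄.D.ω < 1) (hρ₀ : ρ₀ < 1)
    (hnear : (δ + δ') * θ ^ k₀ + cA * (EA₀ + E₀) / (1 - 𝔄.D.ω) ≤ ρ₀) (hB : 0 ≤ B)
    (hfirst : ∀ k < k₀, EA₀ + E₀ ≤ B * θ ^ k) (hsmall : 𝔄.D.ω + G / (1 - ρ₀) * cA < θ') :
    NE5 (𝔄.outA (𝔄.bHist E₀ cB)) (𝔄.outB (𝔄.bHist E₀ cB)) W κ θ'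
      ((G / (1 - ρ₀) * δ + G / (1 - ρ₀) * δ' + B) * (θ' - 𝔄.D.ω) / (θ' - (𝔄.D.ω + G / (1 - ρ₀) * cA))) :=
  ne5_of_assemblyOn_cores 𝔄 𝔠 hact hT hbB hbA hdA hdB hop hins
    (termBudgetLoc_of_actBudgetDecay 𝔄.𝒯 𝔄.inc (A := fun k => factorMass 𝔠 N₀f bf mstar (H k)) hbudD)
    hOp hroom hHist hm hmf hwB hN₀ hNf hqf hH
    (fun k _g _hg _U X _hX i => actMajorant_le_weight 𝔄.𝒯 𝔄.inc (fun k => factorMass 𝔠 N₀f bf mstar (H k)) κ k i X)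
    hE₀ hE₁ hG hcA hcB hδ hδ' hθ hθθ' hθ'1 hω hω1 hρ₀ hnear hB hfirst hsmall

end OverOp

/-! ## §2 On the record sub-slot: the two budget binders from the stripped majorant's decay split and anchored norm -/

section OnSub

variable {G : Type} [GaugeGroup G] {R : TwoRuns G} {E IOp : Type*} {P : MeasPotFrame R.carriers}
  (S₀ : Slots R E IOp (B13HistM P)) (M : Submodule ℂ (OpDatum E))
  (hMA : ∀ g V k, opOf S₀.F S₀.rawA g V k ∈ M) (hMB : ∀ g U k, opOf S₀.F S₀.rawB g U k ∈ M)
  {𝒴 : R.carriers.Dom → InnerLabel R.carriers.Dom (Bnd R) → Type*} {dom : ∀ Z ℓ, 𝒴 Z ℓ → R.carriers.Dom}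
  {PΛ : R.carriers.Dom → InnerLabel R.carriers.Dom (Bnd R) → Type*} {V : R.carriers.Dom → InnerLabel R.carriers.Dom (Bnd R) → Type*}
  [∀ Z ℓ, MeasurableSpace (PΛ Z ℓ)] [∀ Z ℓ, NormedAddCommGroup (V Z ℓ)] [∀ Z ℓ, InnerProductSpace ℝ (V Z ℓ)]
  [∀ Z ℓ, MeasurableSpace (V Z ℓ)] [∀ Z ℓ, BorelSpace (V Z ℓ)] [∀ Z ℓ, FiniteDimensional ℝ (V Z ℓ)]
  (𝔠 : ∀ Z ℓ, BiCore P (dom Z ℓ) M (PΛ Z ℓ) (V Z ℓ)) (E₀ cB : ℝ)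

/-- [folklore] **THE (2.14)-FACTOR-CORE END OF RECORD WITH ITS TERMWISE BUDGET BINDERS READ FROM THE ACTIVITY-NORM CURRENCY.**
/9 §2 `B13AssemblyCoresEnd.ne5_of_record_onSub_cores S₀ M hMA hMB 𝔠 E₀ cB …` (leaf-09's sub-slot (2.14)-face at `act := actOfCores 𝔠`,
cores typed on the sub-slot `M` — of record `↥measOp`, R20) with `a`, `G`, `hmaj`, `hbud : TermBudgetLoc a G` and `hG` DISCHARGED from:
`hκ : 0 ≤ κ`; a nonnegative STRIPPED factor-mass majorant `A′ k` with the factorwise decay split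
`hdec : factorMass 𝔠 N₀f bf m⋆ (H k) Z ℓ ≤ A′ k Z ℓ·e^{−κ(d Z + 5)}` ((2.40)-KIND, displayed); and the anchored exponential norm of `A′ k` on
every `R.domAt k` at most `Φ′` for every anchor cube, `0 ≤ Φ′`, `36Φ′ < 1` ((2.38)+(1.26)-KIND, displayed) — via
`B13TermRepLoc.actMajorant_le_weight` (the budget `hmaj` with equality at the R21 weight) and
`B13TermRepLoc.termBudgetLoc_record_of_actNormDecayU` (leaf-08's Ursell engine on the indexing ∕ hard core OF RECORD, geometry by
`B13DomainGeometryTR`), `G := Φ′∕(1 − 36Φ′)` VOLUME-UNIFORM.  STILL DISPLAYED, VERBATIM and in /9's order: the transport reading `hT`, the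
slice budgets `hbB`∕`hbA` (W3 side), the levels `hdA`∕`hdB` (L05∕L06), W1 in row NE2's entry currency `hRA`∕`hRB`∕`hwer` + floor `hfl`, W4
`hins`, rooms `hOp`∕`hroom`∕`hHist`, the FACTOR operator letters `hm`∕`hmf`∕`hwB`∕`hN₀`∕`hNf`∕`hqf`, the history radius `hH`, numerics (L10
`k₀`∕`B`, L11 `ρ₀`, S with `G ↦ Φ′∕(1 − 36Φ′)`).  Conclusion LITERALLY `NE5 (outA (onSub S₀ M hMA hMB (actOfCores 𝔠)) E₀ cB) (outB (onSub S₀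
M hMA hMB (actOfCores 𝔠)) E₀ cB) W κ θ′ C₅`.  NOT NE5 proved — an implication from displayed binders; nothing instantiated on Bałaban's
concrete objects. -/
theorem ne5_of_record_onSub_cores_actNorm {W : Set (ℕ → ℝ)} {ROp RHist R' H : ℕ → ℝ}
    {N₀f mf bf : R.carriers.Dom → InnerLabel R.carriers.Dom (Bnd R) → ℝ}
    {A' : ℕ → R.carriers.Dom → InnerLabel R.carriers.Dom (Bnd R) → ℝ}
    {mstar κ Φ' EA₀ E₁ cA c₁ r₀ δ' θ θ' ρ₀ B : ℝ} {k₀ : ℕ}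
    (hT : (assembly S₀).TransportReads W)
    (hbB : (assembly S₀).SliceBudgetB W κ cB) (hbA : S₀.D.SliceBudget (step S₀ E₀ cB) W κ cA)
    (hdA : DecayBound (outA (onSub S₀ M hMA hMB (actOfCores 𝔠)) E₀ cB) W EA₀ κ)
    (hdB : DecayBound (outB (onSub S₀ M hMA hMB (actOfCores 𝔠)) E₀ cB) W E₀ κ)
    (hRA : RawBounded S₀.F (assembly S₀).rawAt W) (hRB : RawBounded S₀.F S₀.rawB W)
    (hwer : WeightedEntrywiseRate S₀.F (assembly S₀).rawAt S₀.rawB W c₁ fun k => θ ^ k) (hfl : ∀ k, r₀ ≤ S₀.rOp k)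
    (hins : (step S₀ E₀ cB).InsertionRate W κ E₀ δ' θ)
    (hOp : ∀ k, S₀.rOp k ≤ ROp k) (hroom : ∀ k, ROp k < R' k)
    (hHist : ∀ k, (assembly S₀).bHist E₀ cB k + S₀.rHist k ≤ RHist k)
    -- the FACTOR operator letters of the cores (VERBATIM from /9 §2)
    (hm : 0 < mstar) (hmf : ∀ Z ℓ, mstar ≤ mf Z ℓ) (hwB : ∀ Z ℓ, 0 ≤ (𝔠 Z ℓ).wB) (hN₀ : ∀ Z ℓ, 0 ≤ N₀f Z ℓ)
    (hNf : ∀ k, ∀ g ∈ W, ∀ (U : R.carriers.BgB) (X : R.carriers.Dom), R.carriers.scale X = k →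
      ∀ i, (assembly S₀).𝒯.Rel k i X → ∀ m : Fin ((assembly S₀).𝒯.len i + 1),
      (∀ o ∈ ball (⟨opOf S₀.F S₀.rawB g U k, hMB g U k⟩ : M) (R' k),
        AEStronglyMeasurable ((factorCores (assembly S₀).𝒯 𝔠 i m).N o) (factorCores (assembly S₀).𝒯 𝔠 i m).lam) ∧
      (∀ p, DifferentiableOn ℂ (fun o => (factorCores (assembly S₀).𝒯 𝔠 i m).N o p)
        (ball (⟨opOf S₀.F S₀.rawB g U k, hMB g U k⟩ : M) (R' k))) ∧
      (∀ o ∈ ball (⟨opOf S₀.F S₀.rawB g U k, hMB g U k⟩ : M) (R' k), ∀ p,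
        ‖(factorCores (assembly S₀).𝒯 𝔠 i m).N o p‖ ≤ N₀f ((assembly S₀).𝒯.poly i m) ((assembly S₀).𝒯.lab i m)))
    (hqf : ∀ k, ∀ g ∈ W, ∀ (U : R.carriers.BgB) (X : R.carriers.Dom), R.carriers.scale X = k →
      ∀ i, (assembly S₀).𝒯.Rel k i X → ∀ m : Fin ((assembly S₀).𝒯.len i + 1),
      (∀ o ∈ ball (⟨opOf S₀.F S₀.rawB g U k, hMB g U k⟩ : M) (R' k),
        AEStronglyMeasurable (Function.uncurry ((factorCores (assembly S₀).𝒯 𝔠 i m).q o))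
          ((factorCores (assembly S₀).𝒯 𝔠 i m).lam.prod volume)) ∧
      (∀ p v, DifferentiableOn ℂ (fun o => (factorCores (assembly S₀).𝒯 𝔠 i m).q o p v)
        (ball (⟨opOf S₀.F S₀.rawB g U k, hMB g U k⟩ : M) (R' k))) ∧
      (∀ o ∈ ball (⟨opOf S₀.F S₀.rawB g U k, hMB g U k⟩ : M) (R' k), ∀ p v,
        mf ((assembly S₀).𝒯.poly i m) ((assembly S₀).𝒯.lab i m) * ‖v‖ ^ 2 - bf ((assembly S₀).𝒯.poly i m) ((assembly S₀).𝒯.lab i m) ≤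
          ((factorCores (assembly S₀).𝒯 𝔠 i m).q o p v).re))
    -- the history radius about the record's history reference (VERBATIM)
    (hH : ∀ k, ∀ g ∈ W, ∀ U : R.carriers.BgB, ‖(assembly S₀).histRef g U k‖ + RHist k ≤ H k)
    -- NEW, replacing `a`, `G`, `hmaj`, `hbud`, `hG`: the stripped majorant's decay split and anchored exponential norm
    (hκ : 0 ≤ κ) (hA0' : ∀ k Z ℓ, 0 ≤ A' k Z ℓ)
    (hdec : ∀ k Z ℓ, factorMass 𝔠 N₀f bf mstar (H k) Z ℓ ≤ A' k Z ℓ * Real.exp (-(κ * (R.carriers.d Z + 5))))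
    (hΦ0 : 0 ≤ Φ') (hsmallΦ : 36 * Φ' < 1)
    (hΦ : ∀ (k : ℕ) (q : SCube R),
      ∑ Z ∈ R.domAt k, ind (q ∈ footprint Z) * actSum (b13InnerData R) (A' k) k Z * Real.exp ((footprint Z).card) ≤ Φ')
    (hE₀ : 0 ≤ E₀) (hE₁ : 0 < E₁) (hcA : 0 ≤ cA) (hcB : 0 ≤ cB) (hc₁ : 0 ≤ c₁) (hr₀ : 0 < r₀) (hδ' : 0 ≤ δ')
    (hθ : 0 ≤ θ) (hθθ' : θ ≤ θ') (hθ'1 : θ' ≤ 1) (hω : 0 < S₀.D.ω) (hω1 : S₀.D.ω < 1) (hρ₀ : ρ₀ < 1)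
    (hnear : (c₁ / r₀ + δ') * θ ^ k₀ + cA * (EA₀ + E₀) / (1 - S₀.D.ω) ≤ ρ₀) (hB : 0 ≤ B)
    (hfirst : ∀ k < k₀, EA₀ + E₀ ≤ B * θ ^ k) (hsmall : S₀.D.ω + Φ' / (1 - 36 * Φ') / (1 - ρ₀) * cA < θ') :
    NE5 (outA (onSub S₀ M hMA hMB (actOfCores 𝔠)) E₀ cB) (outB (onSub S₀ M hMA hMB (actOfCores 𝔠)) E₀ cB) W κ θ'
      ((Φ' / (1 - 36 * Φ') / (1 - ρ₀) * (c₁ / r₀) + Φ' / (1 - 36 * Φ') / (1 - ρ₀) * δ' + B) * (θ' - S₀.D.ω) /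
        (θ' - (S₀.D.ω + Φ' / (1 - 36 * Φ') / (1 - ρ₀) * cA))) :=
  -- /9 §2 BY NAME at the R21 weight `a k i X := actMajorant … (factorMass … (H k)) k X i·e^{κd X}`: `hbud` from the anchored norm
  -- (`termBudgetLoc_record_of_actNormDecayU`, record indexing `labelsIndexing (domainGeometry R) (b13InnerData R)` ∕ hard core
  -- `touchInc (domainGeometry R)` = `(assembly S₀).𝒯` ∕ `(assembly S₀).inc` by `rfl`), `hmaj` with equality (`actMajorant_le_weight`).
  ne5_of_record_onSub_cores S₀ M hMA hMB 𝔠 E₀ cB hT hbB hbA hdA hdB hRA hRB hwer hfl hins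
    (termBudgetLoc_record_of_actNormDecayU (R := R) (A := fun k => factorMass 𝔠 N₀f bf mstar (H k)) hκ
      (fun _k Z ℓ => factorMass_nonneg hwB hN₀ hm Z ℓ) hA0' hdec hΦ0 hsmallΦ hΦ)
    hOp hroom hHist hm hmf hwB hN₀ hNf hqf hH
    (fun k _g _hg _U X _hX i => actMajorant_le_weight (labelsIndexing (domainGeometry R) (b13InnerData R))
      (touchInc (domainGeometry R)) (fun k => factorMass 𝔠 N₀f bf mstar (H k)) κ k i X)
    hE₀ hE₁ (div_nonneg hΦ0 (by linarith)) hcA hcB hc₁ hr₀ hδ' hθ hθθ' hθ'1 hω hω1 hρ₀ hnear hB hfirst hsmall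

/-! ## §3 The chained face: the budget discharge of §2 with the arithmetic letters eliminated -/

/-- [folklore] **THE CHAINED FACE: §2 WITH THE ARITHMETIC LETTERS ELIMINATED** (leaf-10's N69 pattern BY NAME —
`B13StepEndArithmetic.reach_elim_iff`, `OutputRateArithmetic.reach_binders_exists`, `B13StepEndArithmetic.smallness_of_gain`; division
of labour with leaf-10-g6, journal l.13419 ∕ l.13517).  §2's `hE₁`∕`hρ₀`∕`hnear`∕`hB`∕`hfirst`∕`hsmall` over the letters `E₁, ρ₀, k₀, B` are REPLACED by
`0 < θ < 1` and the two strict size inequalities `cA(EA₀ + E₀) < 1 − ω` and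
`ω + (Φ′∕(1 − 36Φ′))·cA·(1 − ω)∕(1 − ω − cA(EA₀ + E₀)) < θ′` (`E₁ := 1`); every other binder of §2 VERBATIM ⟹
`∃ C₅, NE5 (outA (onSub S₀ M hMA hMB (actOfCores 𝔠)) E₀ cB) (outB …) W κ θ′ C₅`.  So the most-reduced END of record reads, termwise, from
the factor operator letters + (`A′`, decay split, `Φ′`) and, arithmetically, from sizes only.  NOT NE5 proved. -/
theorem exists_ne5_of_record_onSub_cores_actNorm {W : Set (ℕ → ℝ)} {ROp RHist R' H : ℕ → ℝ}
    {N₀f mf bf : R.carriers.Dom → InnerLabel R.carriers.Dom (Bnd R) → ℝ}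
    {A' : ℕ → R.carriers.Dom → InnerLabel R.carriers.Dom (Bnd R) → ℝ}
    {mstar κ Φ' EA₀ cA c₁ r₀ δ' θ θ' : ℝ}
    (hT : (assembly S₀).TransportReads W)
    (hbB : (assembly S₀).SliceBudgetB W κ cB) (hbA : S₀.D.SliceBudget (step S₀ E₀ cB) W κ cA)
    (hdA : DecayBound (outA (onSub S₀ M hMA hMB (actOfCores 𝔠)) E₀ cB) W EA₀ κ)
    (hdB : DecayBound (outB (onSub S₀ M hMA hMB (actOfCores 𝔠)) E₀ cB) W E₀ κ)
    (hRA : RawBounded S₀.F (assembly S₀).rawAt W) (hRB : RawBounded S₀.F S₀.rawB W)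
    (hwer : WeightedEntrywiseRate S₀.F (assembly S₀).rawAt S₀.rawB W c₁ fun k => θ ^ k) (hfl : ∀ k, r₀ ≤ S₀.rOp k)
    (hins : (step S₀ E₀ cB).InsertionRate W κ E₀ δ' θ)
    (hOp : ∀ k, S₀.rOp k ≤ ROp k) (hroom : ∀ k, ROp k < R' k)
    (hHist : ∀ k, (assembly S₀).bHist E₀ cB k + S₀.rHist k ≤ RHist k)
    -- the FACTOR operator letters of the cores (VERBATIM from /9 §2)
    (hm : 0 < mstar) (hmf : ∀ Z ℓ, mstar ≤ mf Z ℓ) (hwB : ∀ Z ℓ, 0 ≤ (𝔠 Z ℓ).wB) (hN₀ : ∀ Z ℓ, 0 ≤ N₀f Z ℓ)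
    (hNf : ∀ k, ∀ g ∈ W, ∀ (U : R.carriers.BgB) (X : R.carriers.Dom), R.carriers.scale X = k →
      ∀ i, (assembly S₀).𝒯.Rel k i X → ∀ m : Fin ((assembly S₀).𝒯.len i + 1),
      (∀ o ∈ ball (⟨opOf S₀.F S₀.rawB g U k, hMB g U k⟩ : M) (R' k),
        AEStronglyMeasurable ((factorCores (assembly S₀).𝒯 𝔠 i m).N o) (factorCores (assembly S₀).𝒯 𝔠 i m).lam) ∧
      (∀ p, DifferentiableOn ℂ (fun o => (factorCores (assembly S₀).𝒯 𝔠 i m).N o p)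
        (ball (⟨opOf S₀.F S₀.rawB g U k, hMB g U k⟩ : M) (R' k))) ∧
      (∀ o ∈ ball (⟨opOf S₀.F S₀.rawB g U k, hMB g U k⟩ : M) (R' k), ∀ p,
        ‖(factorCores (assembly S₀).𝒯 𝔠 i m).N o p‖ ≤ N₀f ((assembly S₀).𝒯.poly i m) ((assembly S₀).𝒯.lab i m)))
    (hqf : ∀ k, ∀ g ∈ W, ∀ (U : R.carriers.BgB) (X : R.carriers.Dom), R.carriers.scale X = k →
      ∀ i, (assembly S₀).𝒯.Rel k i X → ∀ m : Fin ((assembly S₀).𝒯.len i + 1),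
      (∀ o ∈ ball (⟨opOf S₀.F S₀.rawB g U k, hMB g U k⟩ : M) (R' k),
        AEStronglyMeasurable (Function.uncurry ((factorCores (assembly S₀).𝒯 𝔠 i m).q o))
          ((factorCores (assembly S₀).𝒯 𝔠 i m).lam.prod volume)) ∧
      (∀ p v, DifferentiableOn ℂ (fun o => (factorCores (assembly S₀).𝒯 𝔠 i m).q o p v)
        (ball (⟨opOf S₀.F S₀.rawB g U k, hMB g U k⟩ : M) (R' k))) ∧
      (∀ o ∈ ball (⟨opOf S₀.F S₀.rawB g U k, hMB g U k⟩ : M) (R' k), ∀ p v,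
        mf ((assembly S₀).𝒯.poly i m) ((assembly S₀).𝒯.lab i m) * ‖v‖ ^ 2 - bf ((assembly S₀).𝒯.poly i m) ((assembly S₀).𝒯.lab i m) ≤
          ((factorCores (assembly S₀).𝒯 𝔠 i m).q o p v).re))
    -- the history radius about the record's history reference (VERBATIM)
    (hH : ∀ k, ∀ g ∈ W, ∀ U : R.carriers.BgB, ‖(assembly S₀).histRef g U k‖ + RHist k ≤ H k)
    -- NEW, replacing `a`, `G`, `hmaj`, `hbud`, `hG`: the stripped majorant's decay split and anchored exponential norm
    (hκ : 0 ≤ κ) (hA0' : ∀ k Z ℓ, 0 ≤ A' k Z ℓ)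
    (hdec : ∀ k Z ℓ, factorMass 𝔠 N₀f bf mstar (H k) Z ℓ ≤ A' k Z ℓ * Real.exp (-(κ * (R.carriers.d Z + 5))))
    (hΦ0 : 0 ≤ Φ') (hsmallΦ : 36 * Φ' < 1)
    (hΦ : ∀ (k : ℕ) (q : SCube R),
      ∑ Z ∈ R.domAt k, ind (q ∈ footprint Z) * actSum (b13InnerData R) (A' k) k Z * Real.exp ((footprint Z).card) ≤ Φ')
    (hE₀ : 0 ≤ E₀) (hcA : 0 ≤ cA) (hcB : 0 ≤ cB) (hc₁ : 0 ≤ c₁) (hr₀ : 0 < r₀) (hδ' : 0 ≤ δ')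
    (hθ0 : 0 < θ) (hθ1 : θ < 1) (hθθ' : θ ≤ θ') (hθ'1 : θ' ≤ 1) (hω : 0 < S₀.D.ω) (hω1 : S₀.D.ω < 1)
    (hh : cA * (EA₀ + E₀) < 1 - S₀.D.ω)
    (hsmall : S₀.D.ω + Φ' / (1 - 36 * Φ') * cA * (1 - S₀.D.ω) / (1 - S₀.D.ω - cA * (EA₀ + E₀)) < θ') :
    ∃ C₅, NE5 (outA (onSub S₀ M hMA hMB (actOfCores 𝔠)) E₀ cB) (outB (onSub S₀ M hMA hMB (actOfCores 𝔠)) E₀ cB) W κ θ' C₅ := by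
  obtain ⟨ρ₀, hreach, hρ₀, hs⟩ :=
    (reach_elim_iff (mul_nonneg (div_nonneg hΦ0 (by linarith)) hcA) hω1).mpr ⟨hh, hsmall⟩
  obtain ⟨k₀, B, hB, hnear, hfirst⟩ :=
    reach_binders_exists (D := c₁ / r₀ + δ') (add_nonneg (div_nonneg hc₁ hr₀.le) hδ') hθ0 hθ1 hreach
  exact ⟨_, ne5_of_record_onSub_cores_actNorm S₀ M hMA hMB 𝔠 E₀ cB hT hbB hbA hdA hdB hRA hRB hwer hfl hins hOp hroom hHist hm hmf
    hwB hN₀ hNf hqf hH hκ hA0' hdec hΦ0 hsmallΦ hΦ hE₀ one_pos hcA hcB hc₁ hr₀ hδ' hθ0.le hθθ' hθ'1 hω hω1 hρ₀ hnear hB hfirst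
    (smallness_of_gain hs)⟩

end OnSub

end Summit.QuantumFields.BalabanUV.T4Continuum.B13AssemblyCoresEndActNorm

end
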